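import Literature.NumberTheory.EllipticCurves.JetchevSkinnerWan2017.SigmaLocalCharIdeal
import Literature.NumberTheory.EllipticCurves.SkinnerUrban2014.ShapiroSelmerBigRep
import Literature.NumberTheory.EllipticCurves.Castella2018.AnticyclotomicSelmerDualModuleFinite
import Literature.NumberTheory.EllipticCurves.BigGaloisRepSelmerSigmaChangeProofs
import HarnessLib

/-!
# The ONE-SIDED `Σ`-change `Ch_Λ(X^{Σ₁}_ac) · (P_{Σ₂∖Σ₁}) ⊆ Ch_Λ(X^{Σ₂}_ac)` (and torsion of `X^{Σ₂}_ac`)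
# PROVED from the local fact `sigmaLocal_charIdeal_eulerFactor_mem_of_noTamagawaDefect` and Shapiro

THEOREMS ONLY (no definition, no named fact, no `sorry`); sibling proof file of
`JetchevSkinnerWan2017/SigmaLocalCharIdeal.lean` (the named LOCAL fact). Cell `bsd-stepL` (K2 support
20338 ∕ 20427), seat `bsd-stepL-imc-p1` (prover g12, 2026-08-27).

The Road-FF composition (`P2.RoadFF.SigmaDataAt`) consumes of [JSW17]'s `Σ`-change only the torsion of
`X^Σ_ac` and the ONE-SIDED inclusion `Ch_Λ(X^∅_ac) · (P_Σ) ⊆ Ch_Λ(X^Σ_ac)`, which needs NO surjectivity of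
localisation (JSW Prop. 3.3.2 ∕ Poitou–Tate): exactness of `0 → Sel^{Σ} → Sel^{Σ∪{w}} → H¹(K_w, M)` place by
place, exactness of `Hom(·, ℚ/ℤ)`, multiplicativity of `Ch_Λ` (tree:
`BigGaloisRep.XBigDecomp.isTorsion_and_charIdeal_mul_span_prod_le`), Shapiro ([SU14] Prop. 3.2.3, the tree's
`prop323_XAc_equiv_XBigDecomp`, with Castella's PROVED `XAc.module_finite` for finite generation) and the
local fact at each `w ∈ Σ₂ ∖ Σ₁`.

* **`isTorsion_XAc_and_charIdeal_mul_sigmaEulerFactor_le_of_sigmaLocal_of_prop323`** — for finite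
  `Σ₁ ⊆ Σ₂` away from `p`: `X^{Σ₁}_ac` torsion ⟹ `X^{Σ₂}_ac` torsion ∧
  `Ch_Λ(X^{Σ₁}_ac) · (sigmaEulerFactor (Σ₂ ∖ Σ₁)) ⊆ Ch_Λ(X^{Σ₂}_ac)`;
* `isTorsion_XAc_and_charIdeal_empty_mul_le_of_sigmaLocal_of_prop323` — the case `Σ₁ = ∅` in the glue's
  shape (`P2.RoadFF.SigmaDataAt`).

References: [JetchevSkinnerWan2017] §5.1, proof of Thm. 6.1.6; [Skinner2016PacificMC] §2.3 (p. 180);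
[SkinnerUrban2014] Prop. 3.2.3; [Castella2018] Def. 2.2, (2.7), Prop. 2.5; [GreenbergVatsal2000] Prop. 2.4.
-/

noncomputable section

open scoped Classical
open WeierstrassCurve NumberField IsDedekindDomain Field
open Literature.NumberTheory.EllipticCurves Literature.NumberTheory.EllipticCurves.Castella2018
  Literature.NumberTheory.EllipticCurves.IwasawaCharacter Literature.NumberTheory.EllipticCurves.BigGaloisRep
  Literature.NumberTheory.EllipticCurves.SkinnerUrban2014 Literature.NumberTheory.GaloisRepresentations

namespace Literature.NumberTheory.EllipticCurves.JetchevSkinnerWan2017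

section OneSided

variable (W : WeierstrassCurve ℚ) [W.IsElliptic] (p : ℕ) [Fact p.Prime] (hp : 3 ≤ p)
  (K : Type) [Field K] [NumberField K] (hK : IsImaginaryQuadratic K) (hsplit : SatisfiesHeegnerHypothesis p K)
  (𝔭 : HeightOneSpectrum (𝓞 K)) (h𝔭 : ((p : ℕ) : 𝓞 K) ∈ 𝔭.asIdeal)
  (κ : ZpExtension K p) (hκ : κ.IsAnticyclotomic) (γ : absoluteGaloisGroup K) [Fact (κ.IsTopGenerator γ)]
  (S₁ S₂ : Finset (HeightOneSpectrum (𝓞 K))) (h12 : S₁ ⊆ S₂)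
  (hSp : ∀ w ∈ S₂, ((p : ℕ) : 𝓞 K) ∉ w.asIdeal)
  (Nw : HeightOneSpectrum (𝓞 K) → ℕ) (t : HeightOneSpectrum (𝓞 K) → LocalReductionData)
  (c : HeightOneSpectrum (𝓞 K) → ℤ_[p])
  (hdata : ∀ w ∈ S₂ \ S₁, IsEulerDataAt (W.baseChange K) κ w (Nw w) (t w) (c w))
  (hB : ∀ w ∈ S₂ \ S₁, NoTamagawaDefect p (t w) (c w))

include hp hK hsplit h𝔭 hκ h12 hSp hdata hB

/-- **ONE-SIDED `Σ`-CHANGE, PROVED** from the local fact and Shapiro ([SU14] Prop. 3.2.3): for finite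
`Σ₁ ⊆ Σ₂` away from `p` with Euler data and no Tamagawa defect on `Σ₂ ∖ Σ₁`, if `X^{Σ₁}_ac(E[p^∞])` is
`Λ`-torsion then `X^{Σ₂}_ac(E[p^∞])` is `Λ`-torsion and
**`Ch_Λ(X^{Σ₁}_ac) · (∏_{w∈Σ₂∖Σ₁} P_w) ⊆ Ch_Λ(X^{Σ₂}_ac)`** — the containment half of the display of the
proof of JSW Thm. 6.1.6 (Skinner 2016 §2.3: "`Ch^{Σ₂}_L(f) ⊇ Ch^{Σ₁}_L(f) · ∏_{ℓ∈Σ₂∖Σ₁} (P_ℓ(…))`"), with NO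
surjectivity of localisation used: transport to the big side along Shapiro
(`charIdeal_XAc_eq_charIdeal_XBigDecomp`, `isTorsion_XAc_iff_isTorsion_XBigDecomp`,
`finite_XAc_iff_finite_XBigDecomp` with Castella's `XAc.module_finite`), then
`BigGaloisRep.XBigDecomp.isTorsion_and_charIdeal_mul_span_prod_le` fed by the local fact place by place.
CONDITIONAL on the two named facts `hloc`, `h323` (both published).
[cite: JetchevSkinnerWan2017, proof of Thm. 6.1.6 (arXiv:1512.06894 tex p0026 L82–96)]
[cite: Skinner2016PacificMC, §2.3 (p. 180, "`Ch^{Σ₂}_L(f) ⊇ Ch^{Σ₁}_L(f) · ∏_{ℓ∈Σ₂∖Σ₁} (P_ℓ(Ψ⁻¹ε⁻¹(frob_ℓ)))`")]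
[cite: SkinnerUrban2014, Prop. 3.2.3 (Shapiro)] -/
theorem isTorsion_XAc_and_charIdeal_mul_sigmaEulerFactor_le_of_sigmaLocal_of_prop323
    (hloc : sigmaLocal_charIdeal_eulerFactor_mem_of_noTamagawaDefect) (h323 : prop323_XAc_equiv_XBigDecomp)
    (hT₁ : Module.IsTorsion (IwasawaAlgebra p) (AcSelmer.XAc (W.baseChange K) p κ 𝔭 (↑S₁) γ)) :
    Module.IsTorsion (IwasawaAlgebra p) (AcSelmer.XAc (W.baseChange K) p κ 𝔭 (↑S₂) γ) ∧
      AcSelmer.XAc.charIdeal (W.baseChange K) p κ 𝔭 (↑S₁) γ *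
          Ideal.span {sigmaEulerFactor p ℤ_[p] (S₂ \ S₁) Nw t c} ≤
        AcSelmer.XAc.charIdeal (W.baseChange K) p κ 𝔭 (↑S₂) γ := by
  -- the statements are topology-free; take the discrete topology on `Λ`
  letI : TopologicalSpace (IwasawaAlgebra p) := ⊥
  haveI : DiscreteTopology (IwasawaAlgebra p) := ⟨rfl⟩
  have hS₁fin : (↑S₁ : Set (HeightOneSpectrum (𝓞 K))).Finite := S₁.finite_toSet
  have hS₂fin : (↑S₂ : Set (HeightOneSpectrum (𝓞 K))).Finite := S₂.finite_toSet
  have hS₁p : ∀ w ∈ (↑S₁ : Set (HeightOneSpectrum (𝓞 K))), ((p : ℕ) : 𝓞 K) ∉ w.asIdeal :=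
    fun w hw => hSp w (h12 (Finset.mem_coe.mp hw))
  have hS₂p : ∀ w ∈ (↑S₂ : Set (HeightOneSpectrum (𝓞 K))), ((p : ℕ) : 𝓞 K) ∉ w.asIdeal :=
    fun w hw => hSp w (Finset.mem_coe.mp hw)
  -- Shapiro transport of the hypotheses
  have hT₁' : Module.IsTorsion (IwasawaAlgebra p)
      (XBigDecomp κ ((W.baseChange K).primaryTorsionGaloisRep p) 𝔭 (↑S₁)) :=
    (isTorsion_XAc_iff_isTorsion_XBigDecomp W p hp K hK hsplit 𝔭 h𝔭 _ hS₁fin hS₁p κ hκ γ h323).1 hT₁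
  have hfin : ∀ F' : Finset (HeightOneSpectrum (𝓞 K)), F' ⊆ S₂ \ S₁ →
      Module.Finite (IwasawaAlgebra p)
        (XBigDecomp κ ((W.baseChange K).primaryTorsionGaloisRep p) 𝔭 (↑S₁ ∪ ↑F')) := by
    intro F' hF'
    have hfin' : (↑S₁ ∪ ↑F' : Set (HeightOneSpectrum (𝓞 K))).Finite := hS₁fin.union F'.finite_toSet
    have hp' : ∀ w ∈ (↑S₁ ∪ ↑F' : Set (HeightOneSpectrum (𝓞 K))), ((p : ℕ) : 𝓞 K) ∉ w.asIdeal := by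
      rintro w (hw | hw)
      · exact hS₁p w hw
      · exact hSp w (Finset.sdiff_subset (hF' (Finset.mem_coe.mp hw)))
    haveI := AcSelmer.XAc.module_finite (W.baseChange K) p κ 𝔭 (↑S₁ ∪ ↑F') γ hfin'
    exact (finite_XAc_iff_finite_XBigDecomp W p hp K hK hsplit 𝔭 h𝔭 _ hfin' hp' κ hκ γ h323).1
      inferInstance
  -- the local fact, place by place on `Σ₂ ∖ Σ₁`
  have hloc' : ∀ w ∈ S₂ \ S₁,
      Module.Finite (IwasawaAlgebra p) (CharacterModule (continuousCohomology 1
        ((AnticyclotomicBigGaloisRep κ ((W.baseChange K).primaryTorsionGaloisRep p)).restrict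
          (localMap K (Sum.inl w))).toTopRep)) ∧
      Module.IsTorsion (IwasawaAlgebra p) (CharacterModule (continuousCohomology 1
        ((AnticyclotomicBigGaloisRep κ ((W.baseChange K).primaryTorsionGaloisRep p)).restrict
          (localMap K (Sum.inl w))).toTopRep)) ∧
      eulerFactor p ℤ_[p] (Nw w) (t w) (c w) ∈ Module.charIdeal (IwasawaAlgebra p) (CharacterModule
        (continuousCohomology 1
          ((AnticyclotomicBigGaloisRep κ ((W.baseChange K).primaryTorsionGaloisRep p)).restrict
            (localMap K (Sum.inl w))).toTopRep)) :=
    fun w hw => hloc W p hp K hK κ hκ w (hSp w (Finset.sdiff_subset hw)) (Nw w) (t w) (c w)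
      (hdata w hw) (hB w hw)
  have hF : ∀ w ∈ S₂ \ S₁, w ∉ (↑S₁ : Set (HeightOneSpectrum (𝓞 K))) ∧ ((p : ℕ) : 𝓞 K) ∉ w.asIdeal :=
    fun w hw => ⟨fun h => (Finset.mem_sdiff.mp hw).2 (Finset.mem_coe.mp h), hSp w (Finset.sdiff_subset hw)⟩
  have hS₂eq : (↑S₂ : Set (HeightOneSpectrum (𝓞 K))) = ↑S₁ ∪ ↑(S₂ \ S₁) := by
    rw [← Finset.coe_union, Finset.union_sdiff_of_subset h12]
  -- the big-side one-sided Σ-change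
  obtain ⟨hT₂', hCh'⟩ := XBigDecomp.isTorsion_and_charIdeal_mul_span_prod_le κ
    ((W.baseChange K).primaryTorsionGaloisRep p) 𝔭 (S₂ \ S₁) hF hfin hT₁'
    (fun w => eulerFactor p ℤ_[p] (Nw w) (t w) (c w)) hloc' hS₂eq
  -- back to `X_ac` along Shapiro
  refine ⟨(isTorsion_XAc_iff_isTorsion_XBigDecomp W p hp K hK hsplit 𝔭 h𝔭 _ hS₂fin hS₂p κ hκ γ h323).2
    hT₂', ?_⟩
  rw [charIdeal_XAc_eq_charIdeal_XBigDecomp W p hp K hK hsplit 𝔭 h𝔭 _ hS₁fin hS₁p κ hκ γ h323,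
    charIdeal_XAc_eq_charIdeal_XBigDecomp W p hp K hK hsplit 𝔭 h𝔭 _ hS₂fin hS₂p κ hκ γ h323]
  exact hCh'

end OneSided

/-- **The glue's shape (`Σ₁ = ∅`)**: `X^Σ_ac(E[p^∞])` is `Λ`-torsion and
`Ch_Λ(X^∅_ac) · (P_Σ) ⊆ Ch_Λ(X^Σ_ac)` for a finite `Σ` away from `p` with Euler data and no Tamagawa
defect, from the torsion of `X^∅_ac` (e.g. the control theorem, the tree's
`thm331_anticyclotomicControl_mult`), the local fact and Shapiro — the two conjuncts of the Road-FF shape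
`P2.RoadFF.SigmaDataAt` beyond finiteness and `P_Σ ≠ 0`. CONDITIONAL on `hloc`, `h323`.
[cite: JetchevSkinnerWan2017, proof of Thm. 6.1.6 (arXiv:1512.06894 tex p0026 L82–96)]
[cite: Skinner2016PacificMC, §2.3 (p. 180)] [cite: SkinnerUrban2014, Prop. 3.2.3 (Shapiro)] -/
theorem isTorsion_XAc_and_charIdeal_empty_mul_le_of_sigmaLocal_of_prop323
    (W : WeierstrassCurve ℚ) [W.IsElliptic] (p : ℕ) [Fact p.Prime] (hp : 3 ≤ p)
    (K : Type) [Field K] [NumberField K] (hK : IsImaginaryQuadratic K) (hsplit : SatisfiesHeegnerHypothesis p K)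
    (𝔭 : HeightOneSpectrum (𝓞 K)) (h𝔭 : ((p : ℕ) : 𝓞 K) ∈ 𝔭.asIdeal)
    (κ : ZpExtension K p) (hκ : κ.IsAnticyclotomic) (γ : absoluteGaloisGroup K) [Fact (κ.IsTopGenerator γ)]
    (S : Finset (HeightOneSpectrum (𝓞 K))) (hSp : ∀ w ∈ S, ((p : ℕ) : 𝓞 K) ∉ w.asIdeal)
    (Nw : HeightOneSpectrum (𝓞 K) → ℕ) (t : HeightOneSpectrum (𝓞 K) → LocalReductionData)
    (c : HeightOneSpectrum (𝓞 K) → ℤ_[p])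
    (hdata : ∀ w ∈ S, IsEulerDataAt (W.baseChange K) κ w (Nw w) (t w) (c w))
    (hB : ∀ w ∈ S, NoTamagawaDefect p (t w) (c w))
    (hloc : sigmaLocal_charIdeal_eulerFactor_mem_of_noTamagawaDefect) (h323 : prop323_XAc_equiv_XBigDecomp)
    (hT₀ : Module.IsTorsion (IwasawaAlgebra p) (AcSelmer.XAc (W.baseChange K) p κ 𝔭 ∅ γ)) :
    Module.IsTorsion (IwasawaAlgebra p) (AcSelmer.XAc (W.baseChange K) p κ 𝔭 (↑S) γ) ∧
      AcSelmer.XAc.charIdeal (W.baseChange K) p κ 𝔭 ∅ γ *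
          Ideal.span {sigmaEulerFactor p ℤ_[p] S Nw t c} ≤
        AcSelmer.XAc.charIdeal (W.baseChange K) p κ 𝔭 (↑S) γ := by
  have hT₀' : Module.IsTorsion (IwasawaAlgebra p)
      (AcSelmer.XAc (W.baseChange K) p κ 𝔭 (↑(∅ : Finset (HeightOneSpectrum (𝓞 K)))) γ) := by
    rw [Finset.coe_empty]
    exact hT₀
  have h := isTorsion_XAc_and_charIdeal_mul_sigmaEulerFactor_le_of_sigmaLocal_of_prop323 W p hp K hK
    hsplit 𝔭 h𝔭 κ hκ γ ∅ S (Finset.empty_subset S) hSp Nw t c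
    (fun w hw => hdata w (by simpa only [Finset.sdiff_empty] using hw))
    (fun w hw => hB w (by simpa only [Finset.sdiff_empty] using hw)) hloc h323 hT₀'
  rw [Finset.coe_empty, Finset.sdiff_empty] at h
  exact h


end Literature.NumberTheory.EllipticCurves.JetchevSkinnerWan2017

end
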